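import Summits.QuantumAdvantage.QuantumAdvantage.Theorems.CharDialDisjPencilA

/-! # CharDialDisjPencilB — part 2/4 (mechanical split for landing of `CharDialDisjPencil`; content verbatim; scopes re-opened with their variables) -/

noncomputable section
open Finset
open Summit.QuantumAdvantage.AdviceFreeQNC0 Summit.QuantumAdvantage.AdviceFreeQNC0.JLinPeel

namespace Summit.QuantumAdvantage.AdviceFreeQNC0.WindowCounter
open Summit.QuantumAdvantage.AdviceFreeQNC0 AffBells23

section DisjointPencil
variable (p : ℕ) [Fact p.Prime]

/-- arithmetic: `(3c+4)² ≤ 18c² + 32`. -/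
theorem arith_threeT (c : ℕ) : (3 * c + 4) ^ 2 ≤ 18 * c ^ 2 + 32 := by
  rcases Nat.lt_or_ge c 3 with h | h
  · interval_cases c <;> norm_num
  · nlinarith

/-- arithmetic of the block target: `A·G ≤ 3c+4`, `80·B·X ≤ G²` ⟹ `2(BA)X ≤ c²`. -/
theorem arith_blockTarget {A G B X c : ℕ} (h1 : A * G ≤ 3 * c + 4) (hGX : 80 * B * X ≤ G ^ 2) :
    2 * (B * A) * X ≤ c ^ 2 := by
  have e1 : A * G ^ 2 ≤ (A * G) ^ 2 := by
    rw [mul_pow]; exact Nat.mul_le_mul_right _ (Nat.le_self_pow two_ne_zero A)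
  have e2 : (A * G) ^ 2 ≤ (3 * c + 4) ^ 2 := Nat.pow_le_pow_left h1 2
  have e3 := arith_threeT c
  have e4 : A * (80 * B * X) ≤ A * G ^ 2 := Nat.mul_le_mul_left _ hGX
  set P := B * A * X with hP
  have f1 : A * (80 * B * X) = 80 * P := by rw [hP]; ring
  have f3 : 2 * (B * A) * X = 2 * P := by rw [hP]; ring
  rw [f1] at e4; rw [f3]
  set C := c ^ 2 with hC
  omega

/-- **THE DISJOINT-PENCIL REDUCTION — NO RANK HYPOTHESIS** (`p ≥ 5`): there is `θ₁ < 1`, and for every bell budget `K`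
constants `E`, `N₀` such that for `N ≥ N₀`, every `G` with `E·N·(log₂ N)⁵ ≤ G²`, `m ≤ K·N` generalised bells, and every dial of
`(log₂ N)²`-junta class strategies over a pencil `V_1 … V_R` with PAIRWISE DISJOINT supports each of size `≥ G`:
`#WIN ≤ θ₁·2^N`.  The error sum is bounded by the product formula `Σ_{t≠0} κ^{B₁·#active(t)} ≤ 2(p−1)Rκ^{B₁}` — the number
of directions `R` never enters a threshold. -/
theorem form_reductionDisj (hp : 5 ≤ p) : ∃ θ₁ : ℝ, θ₁ < 1 ∧ ∀ K : ℕ, ∃ E N₀ : ℕ, ∀ N ≥ N₀, ∀ R G : ℕ,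
    E * N * (Nat.log 2 N) ^ 5 ≤ G ^ 2 → ∀ m ≤ K * N,
    ∀ (pat κ : Fin m → ℕ) (V : Fin R → Fin N → ZMod p) (Y : (Fin R → ZMod p) → Fin m → (Fin N → Bool) → Bool),
      (∀ j j', j ≠ j' → ∀ i, V j i = 0 ∨ V j' i = 0) →
      (∀ j, G ≤ (univ.filter fun i : Fin N => V j i ≠ 0).card) →
      (∀ s b, ∃ J : Finset (Fin N), J.card ≤ (Nat.log 2 N) ^ 2 ∧ ∀ u v : Fin N → Bool, (∀ i ∈ J, u i = v i) →
        Y s b u = Y s b v) →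
        (#{u : Fin N → Bool | ringWinGen pat κ (formStratRG p V Y) u = true} : ℝ) ≤ θ₁ * 2 ^ N := by
  classical
  obtain ⟨θ₀, hθ₀, N₀, hN₀⟩ := genMain
  have hpP : p.Prime := Fact.out
  have hp0 : (0 : ℝ) < p := by exact_mod_cast hpP.pos
  have hp1r : (1 : ℝ) ≤ p := by exact_mod_cast hpP.one_lt.le
  have hp2r : (2 : ℝ) ≤ p := by exact_mod_cast hpP.two_le
  have hκ0 := kappaF_nonneg p
  have hκ1 := kappaF_lt_one p hp
  set ε : ℝ := (1 - θ₀) / 2 with hε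
  have hε0 : 0 < ε := by rw [hε]; linarith
  obtain ⟨qa, hqa⟩ := exists_pow_lt_of_lt_one (half_pos hε0) hκ1
  obtain ⟨qb, hqb⟩ := exists_pow_lt_of_lt_one (inv_pos.2 hp0) hκ1
  set q₁ : ℕ := max (max qa qb) 1 with hq₁def
  have hq1 : 1 ≤ q₁ := le_max_right _ _
  have hk1 : kappaF p ^ q₁ ≤ ε / 2 := (pow_le_pow_of_le_one hκ0 hκ1.le ((le_max_left _ _).trans (le_max_left _ _))).trans hqa.le
  have hk2 : kappaF p ^ q₁ ≤ (p : ℝ)⁻¹ := (pow_le_pow_of_le_one hκ0 hκ1.le ((le_max_right _ _).trans (le_max_left _ _))).trans hqb.le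
  refine ⟨θ₀ + ε, by rw [hε]; linarith, fun K => ⟨400 * q₁ * (8 * K + 1), max N₀ 2,
    fun N hN R G hE m hm pat κ V Y hdisj hsupp hY => ?_⟩⟩
  have hNN₀ : N₀ ≤ N := le_trans (le_max_left _ _) hN
  have hN2 : 2 ≤ N := le_trans (le_max_right _ _) hN
  have hN0 : 0 < N := by omega
  have hpr : (0 : ℝ) < (p : ℝ) ^ R := by positivity
  set ℓ := Nat.log 2 N with hℓdef
  have hℓ : 1 ≤ ℓ := Nat.le_log_of_pow_le one_lt_two (by rw [pow_one]; exact hN2)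
  have hℓ4 : 1 ≤ ℓ ^ 4 := Nat.one_le_pow _ _ hℓ
  have hL1 : (ℓ ^ 2 + 1) ^ 2 ≤ 4 * ℓ ^ 4 := by nlinarith [hℓ]
  have hNlt : N < 2 ^ (ℓ + 1) := Nat.lt_pow_succ_log_self one_lt_two N
  -- the block target per active direction: `B₁ = q₁ (ℓ + 4)`
  set B₁ : ℕ := q₁ * (ℓ + 4) with hB₁def
  have hB₁5 : B₁ ≤ 5 * q₁ * ℓ := by
    rw [hB₁def]; calc q₁ * (ℓ + 4) ≤ q₁ * (5 * ℓ) := Nat.mul_le_mul_left _ (by omega)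
      _ = 5 * q₁ * ℓ := by ring
  -- `x = κ^{B₁} ≤ (ε/2)/(p² N)` and `≤ 1/(p³ N)`
  set x : ℝ := kappaF p ^ B₁ with hxdef
  have hx0 : 0 ≤ x := pow_nonneg hκ0 _
  have hpow : ((p : ℝ)⁻¹) ^ (ℓ + 1) ≤ (N : ℝ)⁻¹ := by
    have h1 : ((p : ℝ)⁻¹) ^ (ℓ + 1) ≤ ((2 : ℝ)⁻¹) ^ (ℓ + 1) :=
      pow_le_pow_left₀ (by positivity) (by rw [inv_le_inv₀ hp0 two_pos]; exact hp2r) _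
    have h2 : ((2 : ℝ)⁻¹) ^ (ℓ + 1) ≤ (N : ℝ)⁻¹ := by
      rw [inv_pow, inv_le_inv₀ (by positivity) (by exact_mod_cast hN0)]
      exact_mod_cast hNlt.le
    exact h1.trans h2
  have hxq : x ≤ kappaF p ^ q₁ * ((p : ℝ)⁻¹) ^ (ℓ + 1) * ((p : ℝ)⁻¹) ^ 2 := by
    rw [hxdef, hB₁def, show q₁ * (ℓ + 4) = q₁ + q₁ * (ℓ + 1) + q₁ * 2 by ring, pow_add, pow_add, pow_mul, pow_mul]
    exact mul_le_mul (mul_le_mul_of_nonneg_left (pow_le_pow_left₀ (pow_nonneg hκ0 _) hk2 _) (pow_nonneg hκ0 _))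
      (pow_le_pow_left₀ (pow_nonneg hκ0 _) hk2 _) (pow_nonneg (pow_nonneg hκ0 _) _) (by positivity)
  have hxε : x ≤ ε / 2 * (N : ℝ)⁻¹ * ((p : ℝ)⁻¹) ^ 2 :=
    hxq.trans (mul_le_mul (mul_le_mul hk1 hpow (by positivity) (by positivity)) le_rfl (by positivity) (by positivity))
  have hx1 : x ≤ (p : ℝ)⁻¹ * (N : ℝ)⁻¹ * ((p : ℝ)⁻¹) ^ 2 :=
    hxq.trans (mul_le_mul (mul_le_mul hk2 hpow (by positivity) (by positivity)) le_rfl (by positivity) (by positivity))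
  -- `R ≤ N` (disjoint nonempty supports) and `1 ≤ G`
  have hG1 : 1 ≤ G := by
    have h1 : 1 ≤ 400 * q₁ * (8 * K + 1) * N * ℓ ^ 5 := by
      have hl5 := Nat.one_le_pow 5 ℓ hℓ
      have hE1 : 1 ≤ 400 * q₁ * (8 * K + 1) :=
        calc 1 = 1 * 1 * 1 := by norm_num
          _ ≤ 400 * q₁ * (8 * K + 1) := Nat.mul_le_mul (Nat.mul_le_mul (by norm_num) hq1) (by omega)
      calc 1 = 1 * 1 * 1 := by norm_num
        _ ≤ 400 * q₁ * (8 * K + 1) * N * ℓ ^ 5 := Nat.mul_le_mul (Nat.mul_le_mul hE1 hN0) hl5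
    have h2 : 1 ≤ G ^ 2 := h1.trans hE
    by_contra h0; push Not at h0; interval_cases G; simp at h2
  have hRN : R ≤ N := by
    have hone : ∀ j : Fin R, (fun _ : Fin R => (1 : ZMod p)) j ≠ 0 := fun _ => one_ne_zero
    have e := card_supp_comb_disj p V hdisj (fun _ => (1 : ZMod p))
    have hfilt : (univ.filter fun j : Fin R => (fun _ : Fin R => (1 : ZMod p)) j ≠ 0) = univ :=
      filter_true_of_mem fun j _ => hone j
    rw [hfilt] at e
    have h1 : ∑ j : Fin R, (univ.filter fun i : Fin N => V j i ≠ 0).card ≥ ∑ _j : Fin R, G := sum_le_sum fun j _ => hsupp j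
    rw [sum_const, card_univ, Fintype.card_fin, smul_eq_mul] at h1
    have h2 : (univ.filter fun i : Fin N => comb p (fun _ => (1 : ZMod p)) V i ≠ 0).card ≤ N :=
      (card_filter_le _ _).trans (by rw [card_univ, Fintype.card_fin])
    have h3 : R * G ≤ N := by
      have h4 : R * G ≤ ∑ j : Fin R, (univ.filter fun i : Fin N => V j i ≠ 0).card := h1
      rw [← e] at h4
      exact h4.trans h2
    exact le_trans (Nat.le_mul_of_pos_right R hG1) h3
  -- the product-formula error bound
  have hRx : ((p : ℝ) - 1) * R * x ≤ 1 / 2 := by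
    have hR' : (R : ℝ) ≤ N := by exact_mod_cast hRN
    have hN' : (0 : ℝ) < N := by exact_mod_cast hN0
    calc ((p : ℝ) - 1) * R * x ≤ (p : ℝ) * N * ((p : ℝ)⁻¹ * (N : ℝ)⁻¹ * ((p : ℝ)⁻¹) ^ 2) := by
          apply mul_le_mul (mul_le_mul (by linarith) hR' (by positivity) (by positivity)) hx1 hx0 (by positivity)
      _ = ((p : ℝ)⁻¹) ^ 2 := by field_simp
      _ ≤ ((2 : ℝ)⁻¹) ^ 2 := pow_le_pow_left₀ (by positivity) (by rw [inv_le_inv₀ hp0 two_pos]; exact hp2r) _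
      _ ≤ 1 / 2 := by norm_num
  have herr : ∑ t ∈ univ.erase (0 : Fin R → ZMod p), x ^ (univ.filter fun j : Fin R => t j ≠ 0).card ≤ ε := by
    refine (sum_pow_active_le p hx0 hRx).trans ?_
    have hR' : (R : ℝ) ≤ N := by exact_mod_cast hRN
    have hN' : (0 : ℝ) < N := by exact_mod_cast hN0
    calc 2 * (((p : ℝ) - 1) * R * x) ≤ 2 * ((p : ℝ) * N * (ε / 2 * (N : ℝ)⁻¹ * ((p : ℝ)⁻¹) ^ 2)) := by
          apply mul_le_mul_of_nonneg_left _ (by norm_num)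
          exact mul_le_mul (mul_le_mul (by linarith) hR' (by positivity) (by positivity)) hxε hx0 (by positivity)
      _ = ε * (p : ℝ)⁻¹ := by field_simp
      _ ≤ ε * 1 := mul_le_mul_of_nonneg_left (inv_le_one_of_one_le₀ hp1r) hε0.le
      _ = ε := mul_one _
  -- the threshold: `G² ≥ 80·B₁·(2m(L+1)² + N)` with `L = ℓ²`
  set X : ℕ := 2 * (m * (ℓ ^ 2 + 1) ^ 2) + N with hXdef
  have hX : X ≤ (8 * K + 1) * ℓ ^ 4 * N := by
    rw [hXdef]
    calc 2 * (m * (ℓ ^ 2 + 1) ^ 2) + N ≤ 2 * (K * N * (4 * ℓ ^ 4)) + N * ℓ ^ 4 :=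
          add_le_add (Nat.mul_le_mul_left _ (Nat.mul_le_mul hm hL1)) (by
            calc N = N * 1 := (mul_one _).symm
              _ ≤ N * ℓ ^ 4 := Nat.mul_le_mul_left _ hℓ4)
      _ = (8 * K + 1) * ℓ ^ 4 * N := by ring
  have hGX : 80 * B₁ * X ≤ G ^ 2 :=
    calc 80 * B₁ * X ≤ 80 * (5 * q₁ * ℓ) * ((8 * K + 1) * ℓ ^ 4 * N) := Nat.mul_le_mul (Nat.mul_le_mul_left _ hB₁5) hX
      _ = 400 * q₁ * (8 * K + 1) * N * ℓ ^ 5 := by ring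
      _ ≤ G ^ 2 := hE
  -- per-`t` bias via the prescribed good starts of `comb t V`
  have hbias : ∀ s : Fin R → ZMod p, ∀ t ∈ univ.erase (0 : Fin R → ZMod p),
      ‖formSumG p pat κ (comb p t V) (Y s) 1‖ ≤ x ^ (univ.filter fun j : Fin R => t j ≠ 0).card * 2 ^ N := by
    intro s t _
    set A : ℕ := (univ.filter fun j : Fin R => t j ≠ 0).card with hAdef
    have hsuppc : A * G ≤ (univ.filter fun i : Fin N => comb p t V i ≠ 0).card := by
      rw [card_supp_comb_disj p V hdisj t]
      calc A * G = ∑ _j ∈ univ.filter (fun j : Fin R => t j ≠ 0), G := by rw [sum_const, smul_eq_mul]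
        _ ≤ _ := sum_le_sum fun j _ => hsupp j
    obtain ⟨T, hTn, hTgd, hTsep, hTle, hTc⟩ := exists_goodT p (comb p t V)
    have hB : 2 * (B₁ * A) * X ≤ T.card ^ 2 := arith_blockTarget (hsuppc.trans hTc) hGX
    have hx' : kappaF p ^ (B₁ * A) = x ^ A := by rw [hxdef, ← pow_mul]
    have := formJunta_blocksT p hp (B₁ * A) pat κ (comb p t V) (Y s) (hY s) T hTn hTgd hTsep hTle hN0 hB 1 one_ne_zero
    rwa [hx'] at this
  -- class counting, as in `form_reductionRGD`
  have hcls : ∀ s : Fin R → ZMod p,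
      (p : ℝ) ^ R * #{u : Fin N → Bool | ringWinGen pat κ (Y s) u = true ∧ vecF p V u = s} ≤ θ₀ * 2 ^ N + ε * 2 ^ N := by
    intro s
    refine le_trans (class_count_le_formRG p pat κ V (Y s) s) (add_le_add (hN₀ N hNN₀ m pat κ _ (hY s)) ?_)
    calc ∑ t ∈ univ.erase (0 : Fin R → ZMod p), ‖formSumG p pat κ (comb p t V) (Y s) 1‖
        ≤ ∑ t ∈ univ.erase (0 : Fin R → ZMod p), x ^ (univ.filter fun j : Fin R => t j ≠ 0).card * 2 ^ N :=
          sum_le_sum fun t ht => hbias s t ht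
      _ = (∑ t ∈ univ.erase (0 : Fin R → ZMod p), x ^ (univ.filter fun j : Fin R => t j ≠ 0).card) * 2 ^ N := by
          rw [sum_mul]
      _ ≤ ε * 2 ^ N := mul_le_mul_of_nonneg_right herr (by positivity)
  have hsum : (p : ℝ) ^ R * #{u : Fin N → Bool | ringWinGen pat κ (formStratRG p V Y) u = true} ≤
      (p : ℝ) ^ R * (θ₀ * 2 ^ N + ε * 2 ^ N) := by
    rw [card_win_formRG_eq_sum p pat κ V Y]
    push_cast
    rw [mul_sum]
    calc _ ≤ ∑ s : Fin R → ZMod p, (θ₀ * 2 ^ N + ε * 2 ^ N) := sum_le_sum fun s _ => hcls s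
      _ = (p : ℝ) ^ R * (θ₀ * 2 ^ N + ε * 2 ^ N) := by
          rw [sum_const, card_univ, Fintype.card_fun, ZMod.card, Fintype.card_fin, nsmul_eq_mul]; push_cast; ring
  have := le_of_mul_le_mul_left hsum hpr
  linarith

end DisjointPencil

end Summit.QuantumAdvantage.AdviceFreeQNC0.WindowCounter

namespace Summit.QuantumAdvantage.AdviceFreeQNC0.JLinPeel

open AffBells22 AffBells23 Subcube

section DisjointPencilD

variable (p : ℕ) [Fact p.Prime] {n : ℕ}

/-- **disjoint pencils on half-size subcubes** (transport §22 + `form_reductionDisj`): `2|W| ≤ n`, `E·n·(log₂ n)⁵ ≤ G²`, a pencil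
`V_1 … V_R` with pairwise disjoint supports each having `≥ G` nonzero coefficients OFF `W`, `log₂ n`-junta tables ⟹
`#{u : WIN(merge_W β u)} ≤ θ·2ⁿ`. -/
theorem disj_denseD (hp : 5 ≤ p) : ∃ θ : ℝ, θ < 1 ∧ ∃ E n₀ : ℕ, ∀ n ≥ n₀, ∀ (R G : ℕ),
    E * n * (Nat.log 2 n) ^ 5 ≤ G ^ 2 →
    ∀ (W : Finset (Fin n)) (β : Fin n → Bool) (c : ℕ) (V : Fin R → Fin n → ZMod p)
      (Y : (Fin R → ZMod p) → Fin (n + 1) → (Fin n → Bool) → Bool),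
      2 * W.card ≤ n →
      (∀ s g, ∃ J : Finset (Fin n), J.card ≤ Nat.log 2 n ∧ ∀ u v : Fin n → Bool, (∀ i ∈ J, u i = v i) →
        Y s g u = Y s g v) →
      (∀ j j', j ≠ j' → ∀ i, V j i = 0 ∨ V j' i = 0) →
      (∀ j, G ≤ (univ.filter fun i : Fin n => i ∉ W ∧ V j i ≠ 0).card) →
      ((univ.filter fun u : Fin n → Bool =>
          ringWinU c (WindowCounter.formStratR p V Y) (subcubeMerge W β u) = true).card : ℝ) ≤ θ * 2 ^ n := by
  obtain ⟨θ₁, hθ₁, hred⟩ := WindowCounter.form_reductionDisj p hp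
  obtain ⟨E, N₀, hN₀⟩ := hred 3
  obtain ⟨N₁, hN₁⟩ := WindowCounter.log_le_sq_log 2
  set M := max (max N₀ N₁) 1 with hMdef
  refine ⟨θ₁, hθ₁, E, 2 * M, fun n hn R G hE W β c V Y hW hY hdisj hsupp => ?_⟩
  set N := n - W.card with hNdef
  have hWn : W.card + N = n := card_add_sub W
  have hnN : n ≤ 2 * N := by omega
  have hMN : M ≤ N := by omega
  have hNN₀ : N₀ ≤ N := le_trans (le_trans (le_max_left _ _) (le_max_left _ _)) hMN
  have hNN₁ : N₁ ≤ N := le_trans (le_trans (le_max_right _ _) (le_max_left _ _)) hMN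
  have hN1 : 1 ≤ N := le_trans (le_max_right _ _) hMN
  have hNn : N ≤ n := Nat.sub_le _ _
  have hE' : E * N * (Nat.log 2 N) ^ 5 ≤ G ^ 2 :=
    le_trans (Nat.mul_le_mul (Nat.mul_le_mul_left _ hNn) (Nat.pow_le_pow_left (Nat.log_mono_right hNn) 5)) hE
  -- counting on the subcube ≤ 2^{|W|} · counting on the free cube
  have h1 := card_filter_merge_le W β (fun u : Fin n → Bool => ringWinU c (WindowCounter.formStratR p V Y) u = true)
  -- the free game is the generalised dial of the restricted directions
  set σ : Fin R → ZMod p := fun j => ∑ i ∈ W, if β i = true then V j i else 0 with hσ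
  set V' : Fin R → Fin N → ZMod p := fun j => res W (V j) with hV'
  set Y' : (Fin R → ZMod p) → Fin (n + 1) → (Fin N → Bool) → Bool := fun s g v => Y (σ + s) g (ext W β v) with hY'
  have hstr : (fun g (v : Fin N → Bool) => WindowCounter.formStratR p V Y g (ext W β v)) =
      WindowCounter.formStratRG p V' Y' := by
    funext g v
    show Y (WindowCounter.vecF p V (ext W β v)) g (ext W β v) = Y (σ + WindowCounter.vecF p V' v) g (ext W β v)
    rw [vecF_ext]
  have h2 : ∀ v : Fin N → Bool, ringWinU c (WindowCounter.formStratR p V Y) (ext W β v) =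
      ringWinGen (fun g : Fin (n + 1) => cut W g.val)
        (fun g : Fin (n + 1) => c + g.val + (SubcubeBells.wW W β + SubcubeBells.pW W β g.val))
        (WindowCounter.formStratRG p V' Y') v := fun v => by
    rw [SubcubeBells.ringWinU_ext, hstr]
  have hm : n + 1 ≤ 3 * N := by omega
  have hdisj' : ∀ j j', j ≠ j' → ∀ i : Fin N, V' j i = 0 ∨ V' j' i = 0 := fun j j' hne i => hdisj j j' hne (emb W i)
  have hsupp' : ∀ j, G ≤ (univ.filter fun i : Fin N => V' j i ≠ 0).card := fun j => by
    have e : (univ.filter fun i : Fin N => V' j i ≠ 0).card =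
        (univ.filter fun i : Fin n => i ∉ W ∧ V j i ≠ 0).card := SubcubeBells.card_supp_res W (V j)
    rw [e]; exact hsupp j
  have hY'' : ∀ s g, ∃ J : Finset (Fin N), J.card ≤ (Nat.log 2 N) ^ 2 ∧ ∀ u v : Fin N → Bool,
      (∀ i ∈ J, u i = v i) → Y' s g u = Y' s g v := fun s g => by
    obtain ⟨J, hJ, hdep⟩ := hY (σ + s) g
    obtain ⟨J', hJ', hdep'⟩ := SubcubeBells.junta_ext W β (f := fun u => Y (σ + s) g u) hdep
    exact ⟨J', hJ'.trans (hJ.trans (hN₁ N hNN₁ n hnN)), hdep'⟩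
  have h3 := hN₀ N hNN₀ R G hE' (n + 1) hm (fun g : Fin (n + 1) => cut W g.val)
    (fun g : Fin (n + 1) => c + g.val + (SubcubeBells.wW W β + SubcubeBells.pW W β g.val)) V' Y' hdisj' hsupp' hY''
  have h4 : ((univ.filter fun v : Fin N → Bool =>
      ringWinU c (WindowCounter.formStratR p V Y) (ext W β v) = true).card : ℝ) ≤ θ₁ * 2 ^ N := by
    have e : (univ.filter fun v : Fin N → Bool => ringWinU c (WindowCounter.formStratR p V Y) (ext W β v) = true) =
        univ.filter fun v : Fin N → Bool => ringWinGen (fun g : Fin (n + 1) => cut W g.val)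
          (fun g : Fin (n + 1) => c + g.val + (SubcubeBells.wW W β + SubcubeBells.pW W β g.val))
          (WindowCounter.formStratRG p V' Y') v = true := filter_congr fun v _ => by rw [h2]
    rw [e]
    exact h3
  have h2n : (2 : ℝ) ^ n = 2 ^ W.card * 2 ^ N := by rw [← pow_add, hWn]
  calc ((univ.filter fun u : Fin n → Bool =>
          ringWinU c (WindowCounter.formStratR p V Y) (subcubeMerge W β u) = true).card : ℝ)
      ≤ 2 ^ W.card * ((univ.filter fun v : Fin N → Bool =>
          ringWinU c (WindowCounter.formStratR p V Y) (ext W β v) = true).card : ℝ) := by exact_mod_cast h1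
    _ ≤ 2 ^ W.card * (θ₁ * 2 ^ N) := mul_le_mul_of_nonneg_left h4 (by positivity)
    _ = θ₁ * 2 ^ n := by rw [h2n]; ring


end DisjointPencilD
end Summit.QuantumAdvantage.AdviceFreeQNC0.JLinPeel
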